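import Summits.BirchSwinnertonDyer.BirchSwinnertonDyer.Theorems.GenusKolyvaginAtTwoPowDvdShaCardAtTwoRTHalfTransverseIsotropic
import Literature.NumberTheory.GaloisRepresentations.DecompositionGroupNested
import HarnessLib

/-!
# Route `GenusKolyvaginAtTwo`, crux L_T `PowDvdShaCardAtTwoRT` (stmt-BirchSwinnertonDyer-23242), LINE 18 stub L, bottom rung:
# THE HALF-TRANSVERSE LOCAL CONDITION `M_ℓ ≤ H¹(K_v, E[n])` AT A DEEP OWN PRIME — definition, index `≤ 2`, and the bridge to
# the `h1Eval` currency

Seat `bsd-line-gk2-p3` g21 (PROVER seat 3/3, cell `bsd-f1-sign2`), `--supports 23242`.  ONE DEFINITION (`halfTransverseLocal`, the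
object the index-`≥ 2` bottom-rung engine of LINE 18 posits as the local condition at a deep own prime — LEAD memo
`Cruxes/PowDvdShaCardAtTwoRT/Lines/plus-descent-lead-g16.md` §2/§8 and this seat's `Lines/plus-descent-deep-own-prime-gk2p3.md` §3)
and its basic theorems; no named fact, no `sorry`.  BSD is NOT proved by any of this; neither is the crux nor stub L.

WHY.  The engine pairs `X = 2·Z` (`Z = desc c₂(nℓ′) ∈ H¹(ℚ, E^ε[4])`) with an auxiliary `y` produced by a Poitou–Tate COUNT
(`…RTOrderFourAuxiliaryGeneral.exists_mem_kummerOutside_four_localization_mem_two_nsmul_ne_zero_of_index_le_two`, p701532: any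
local conditions `M_u` of INDEX `≤ 2` at the deep own primes `t`, one free place).  The condition at `ℓ ∈ t` must (a) be a definite
`AddSubgroup` of `H¹(ℚ_ℓ, E[4])` fixed BEFORE the new prime `ℓ′` is chosen (the «`ℓ′` first, `M_ℓ := (X_ℓ)^⊥`» shortcut is
self-defeating: reciprocity then forces `2·loc_{ℓ′} y = 0`, memo §2), (b) have index `≤ 2`, and (c) make the own-prime term
`⟨X_ℓ, y_ℓ⟩ = loc(2Z) ∪ loc y` vanish — which, by this seat's I7½ (`…RTHalfTransverseIsotropic(Packaged)`, p702376: `2^{M−1}·(loc x ∪ loc y) = 0`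
for two HALF-TRANSVERSE classes), holds as soon as `loc y ∈ M_ℓ` implies «`y` is half-transverse at `ℓ`», i.e. `[y, F] ∈ (F−1)T + 2T`.
DEFINITION (§2): for a `K`-field `E` (a completion) and `g₀ ∈ Γ_E` (a local lift of the Frobenius `F`),
**`halfTransverseLocal W n E g₀ := {c ∈ H¹(Γ_E, E[n]) : some cocycle f of c has f(g₀) ∈ (res g₀ − 1)T + 2T}`**;
well defined (§2: EVERY cocycle of `c` then has this property, coboundary values at `g₀` lying in `(res g₀ − 1)T`), and:
* (b) **`index_halfTransverseLocal_le_two`** (§3) — for `T = E[n]` free of rank one over `ℤ/q[res g₀]` with `q` even, `(F−1)T + 2T` has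
  index `2` in `T` (coordinates `xP + yFP ↦ x + y mod 2`, §1), so two classes outside `M` differ by a class inside: index `1` or `2`
  (`AddSubgroup.index_eq_two_iff`).  NO local class field theory, no local duality, no Frobenius generation is used.
* (c) **`localization_mem_halfTransverseLocal_iff`** (§4) — for a GLOBAL class `y`, `loc_v y ∈ halfTransverseLocal W n K_v g₀ ↔
  ∃ a b, [y, res g₀] = (res g₀ • a − a) + 2•b`, the half-transversality hypothesis of `…RTHalfTransverseIsotropic` at `F := res g₀`.
* (a) **`exists_absGaloisRestrict_eq_of_mem_decompositionSubgroup`** / `…_of_isArithFrobAt` (§4) — every `F ∈ D_𝔓`, `𝔓 = ι₀⁻¹𝔐` the prime of the chosen embedding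
  (`v.primeBelow (closureEmb) 𝔐`, the prime of I7/I7½), IS `res g₀` for some `g₀ ∈ Γ_{K_v}` (`D_𝔓 = res Γ_{K_v}`:
  `decompositionSubgroup_adicCompletionPrime_eq_range` + `eq_of_decompositionSubgroup_le`), so the engine may take `g₀` over its Frobenius `F`.
HONEST FRAMING: definition + bookkeeping; the arithmetic («`Z` is half-transverse», the count, the reciprocity) is elsewhere.  BSD is NOT proved.

References: [McCallumLMS1991] §5 Lemma 5.3 and proof of Prop. 5.2; [NeukirchANT1999] Ch. II §9 Prop. (9.6); [SerreGaloisCohomology1997] I §2.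
-/

set_option autoImplicit false
set_option linter.dupNamespace false -- tree convention: `Summit.BirchSwinnertonDyer.BirchSwinnertonDyer.Theorems` (summit = sub-problem)

noncomputable section
open scoped Classical Pointwise
universe u

namespace Summit.BirchSwinnertonDyer.BirchSwinnertonDyer.Theorems.GenusExact.TransverseIsotropy

open WeierstrassCurve NumberField IsDedekindDomain Field
open Literature.NumberTheory.EllipticCurves Literature.NumberTheory.GaloisRepresentations
open Literature.NumberTheory.GaloisCohomology

/-! ## §1 The subgroup `(F − 1)T + 2T` of `T = E[n]` has index `2` -/

section Algebra

variable {K : Type u} [Field K] (W : WeierstrassCurve K) {n : ℤ} {F : absoluteGaloisGroup K} {q : ℤ}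
  {P : geomTorsion W n}

/-- `0 ∈ (F−1)T + 2T`. [folklore] -/
theorem zero_mem_smulSubAddTwo : ∃ a b : geomTorsion W n, (0 : geomTorsion W n) = (F • a - a) + (2 : ℤ) • b :=
  ⟨0, 0, by rw [smul_zero, sub_zero, smul_zero, add_zero]⟩

/-- `(F−1)T + 2T` is closed under addition. [folklore] -/
theorem add_mem_smulSubAddTwo {v w : geomTorsion W n} (hv : ∃ a b : geomTorsion W n, v = (F • a - a) + (2 : ℤ) • b)
    (hw : ∃ a b : geomTorsion W n, w = (F • a - a) + (2 : ℤ) • b) :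
    ∃ a b : geomTorsion W n, v + w = (F • a - a) + (2 : ℤ) • b := by
  obtain ⟨a, b, rfl⟩ := hv
  obtain ⟨a', b', rfl⟩ := hw
  exact ⟨a + a', b + b', by rw [smul_add, smul_add]; abel⟩

/-- `(F−1)T + 2T` is closed under negation. [folklore] -/
theorem neg_mem_smulSubAddTwo {v : geomTorsion W n} (hv : ∃ a b : geomTorsion W n, v = (F • a - a) + (2 : ℤ) • b) :
    ∃ a b : geomTorsion W n, -v = (F • a - a) + (2 : ℤ) • b := by
  obtain ⟨a, b, rfl⟩ := hv
  exact ⟨-a, -b, by rw [smul_neg, smul_neg]; abel⟩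

/-- **Coordinates: `xP + yFP ∈ (F−1)T + 2T ↔ x + y` is even**, for `T = E[n]` free of rank one over `ℤ/q[F]` on `P` (`F² = 1` on `T`,
`qP = 0`, `q` even).  (`⟸`: `xP + yFP = (F(yP) − yP) + 2kP` with `x + y = 2k`; `⟹`: compare coordinates mod `q`, which is even.) [folklore] -/
theorem exists_smul_sub_add_two_smul_iff_even (hF : ∀ Q : geomTorsion W n, F • F • Q = Q) (hq : (2 : ℤ) ∣ q)
    (hfree : ∀ x y : ℤ, x • P + y • F • P = 0 → q ∣ x ∧ q ∣ y)
    (hgen : ∀ Q : geomTorsion W n, ∃ x y : ℤ, Q = x • P + y • F • P) (x y : ℤ) :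
    (∃ a b : geomTorsion W n, x • P + y • F • P = (F • a - a) + (2 : ℤ) • b) ↔ Even (x + y) := by
  constructor
  · rintro ⟨a, b, hab⟩
    obtain ⟨s, t, rfl⟩ := hgen a
    obtain ⟨u, w, rfl⟩ := hgen b
    -- `F a - a + 2 b = (t - s + 2u) P + (s - t + 2w) F P`
    have hre : (F • (s • P + t • F • P) - (s • P + t • F • P)) + (2 : ℤ) • (u • P + w • F • P) =
        (t - s + 2 * u) • P + (s - t + 2 * w) • F • P := by
      rw [smul_add, smul_comm F s P, smul_comm F t (F • P), hF, smul_add, smul_smul, smul_smul, add_smul, add_smul, sub_smul,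
        sub_smul, mul_smul, mul_smul]
      abel
    rw [hre] at hab
    have h0 : (x - (t - s + 2 * u)) • P + (y - (s - t + 2 * w)) • F • P = 0 := by
      rw [sub_smul, sub_smul, sub_add_sub_comm, hab, sub_self]
    obtain ⟨⟨k₁, hk₁⟩, ⟨k₂, hk₂⟩⟩ := hfree _ _ h0
    obtain ⟨m, rfl⟩ := hq
    exact ⟨m * k₁ + m * k₂ + u + w, by linear_combination hk₁ + hk₂⟩
  · rintro ⟨k, hk⟩
    refine ⟨y • P, k • P, ?_⟩
    rw [smul_comm F y P]
    have hx : x = k + k - y := by omega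
    rw [hx, sub_smul, add_smul, two_smul]
    abel

/-- **Two elements outside `(F−1)T + 2T` differ by one inside** (the subgroup has index `2`). [folklore] -/
theorem add_mem_smulSubAddTwo_of_not_mem (hF : ∀ Q : geomTorsion W n, F • F • Q = Q) (hq : (2 : ℤ) ∣ q)
    (hfree : ∀ x y : ℤ, x • P + y • F • P = 0 → q ∣ x ∧ q ∣ y)
    (hgen : ∀ Q : geomTorsion W n, ∃ x y : ℤ, Q = x • P + y • F • P) {v w : geomTorsion W n}
    (hv : ¬ ∃ a b : geomTorsion W n, v = (F • a - a) + (2 : ℤ) • b)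
    (hw : ¬ ∃ a b : geomTorsion W n, w = (F • a - a) + (2 : ℤ) • b) :
    ∃ a b : geomTorsion W n, v + w = (F • a - a) + (2 : ℤ) • b := by
  obtain ⟨x₁, y₁, rfl⟩ := hgen v
  obtain ⟨x₂, y₂, rfl⟩ := hgen w
  rw [exists_smul_sub_add_two_smul_iff_even W hF hq hfree hgen] at hv hw
  have hsum : (x₁ • P + y₁ • F • P) + (x₂ • P + y₂ • F • P) = (x₁ + x₂) • P + (y₁ + y₂) • F • P := by
    rw [add_smul, add_smul]; abel
  rw [hsum, exists_smul_sub_add_two_smul_iff_even W hF hq hfree hgen]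
  rw [Int.not_even_iff_odd] at hv hw
  have : x₁ + x₂ + (y₁ + y₂) = (x₁ + y₁) + (x₂ + y₂) := by ring
  rw [this]
  exact hv.add_odd hw

end Algebra

/-! ## §2 The half-transverse local condition -/

section LocalDef

variable {K : Type u} [Field K] (W : WeierstrassCurve K) (n : ℤ) (E : Type u) [Field E] [Algebra K E]

/-- **The half-transverse local condition** `halfTransverseLocal W n E g₀ ≤ H¹(Γ_E, E[n]|_{Γ_E})` at a `K`-field `E` (a completion `K_v`)
with respect to an element `g₀ ∈ Γ_E` (a local lift of the Frobenius): the classes having a continuous cocycle `f` whose value at `g₀`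
lies in `(res g₀ − 1)·E[n] + 2·E[n]`.  At a Kolyvagin prime of depth `M ≥ 2` for `p = 2` (`res g₀` acting on `T = E[2^M]` as a regular
involution `F`) this is `H¹_tr ⊕ H¹_f[2] = (2^{M−1}•)⁻¹ H¹_tr`, the index-`2` subgroup of classes `c` such that `2^{M−1}c` is
transverse — the local condition imposed on the auxiliary class at a DEEP own prime in LINE 18's index-`≥ 2` bottom-rung engine
(McCallum's Prop. 5.2 at `2`, level raised by one).  [cite: McCallumLMS1991, §5 Lemma 5.3 and proof of Prop. 5.2] -/
def halfTransverseLocal (g₀ : absoluteGaloisGroup E) :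
    AddSubgroup (galoisCohomology (GaloisRep.restrictField E (W.torsionGaloisModule n)) 1) where
  carrier := {c | ∃ f : contOneCocycles (DiscreteGaloisModule.toTopRep (GaloisRep.restrictField E (W.torsionGaloisModule n))),
    oneCocycleClass _ f = c ∧
      ∃ a b : geomTorsion W n, f.1 g₀ = (absGaloisRestrict K E g₀ • a - a) + (2 : ℤ) • b}
  zero_mem' := ⟨0, oneCocycleClass_zero _, by
    rw [Submodule.coe_zero, ContinuousMap.zero_apply]; exact zero_mem_smulSubAddTwo W⟩
  add_mem' := by
    rintro c c' ⟨f, rfl, hf⟩ ⟨f', rfl, hf'⟩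
    refine ⟨f + f', oneCocycleClass_add _ f f', ?_⟩
    rw [Submodule.coe_add, ContinuousMap.add_apply]
    exact add_mem_smulSubAddTwo W hf hf'
  neg_mem' := by
    rintro c ⟨f, rfl, hf⟩
    refine ⟨-f, ?_, ?_⟩
    · rw [← oneCocycleClassₗ_apply, map_neg, oneCocycleClassₗ_apply]
      rfl
    · rw [Submodule.coe_neg, ContinuousMap.neg_apply]
      exact neg_mem_smulSubAddTwo W hf

variable {W n E}

/-- The action of `Γ_E` on `E[n]|_{Γ_E}` is through `res : Γ_E → Γ_K`. [folklore] -/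
theorem toTopRep_restrictField_ρ_apply (g : absoluteGaloisGroup E) (a : geomTorsion W n) :
    (DiscreteGaloisModule.toTopRep (GaloisRep.restrictField E (W.torsionGaloisModule n))).ρ g a =
      absGaloisRestrict K E g • a := rfl

/-- **Well-definedness**: if `c ∈ halfTransverseLocal` then EVERY cocycle `f` of `c` has `f(g₀) ∈ (res g₀ − 1)T + 2T` (two cocycles of
`c` differ by a coboundary `g ↦ gR − R`, whose value at `g₀` lies in `(res g₀ − 1)T`). [cite: SerreGaloisCohomology1997, I §2] -/
theorem mem_halfTransverseLocal_iff {g₀ : absoluteGaloisGroup E}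
    (f : contOneCocycles (DiscreteGaloisModule.toTopRep (GaloisRep.restrictField E (W.torsionGaloisModule n))))
    {c : galoisCohomology (GaloisRep.restrictField E (W.torsionGaloisModule n)) 1} (hfc : oneCocycleClass _ f = c) :
    c ∈ halfTransverseLocal W n E g₀ ↔
      ∃ a b : geomTorsion W n, f.1 g₀ = (absGaloisRestrict K E g₀ • a - a) + (2 : ℤ) • b := by
  constructor
  · rintro ⟨f', hf'c, a, b, hab⟩
    have h0 : oneCocycleClass _ (f - f') = 0 := by rw [oneCocycleClass_sub, hfc, hf'c, sub_self]
    obtain ⟨R, hR⟩ := (oneCocycleClass_eq_zero_iff _ (f - f')).mp h0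
    have hg₀ := hR g₀
    rw [Submodule.coe_sub, ContinuousMap.sub_apply, toTopRep_restrictField_ρ_apply, sub_eq_iff_eq_add] at hg₀
    refine ⟨R + a, b, ?_⟩
    rw [hg₀, hab, smul_add]
    abel
  · rintro h
    exact ⟨f, hfc, h⟩

end LocalDef

/-! ## §3 The index is at most `2` -/

section Index

variable {K : Type u} [Field K] (W : WeierstrassCurve K) (n : ℤ) (E : Type u) [Field E] [Algebra K E]

/-- **`halfTransverseLocal` has index `≤ 2`** when `res g₀` acts on `T = E[n]` as a regular involution (`T` free of rank one over `ℤ/q[res g₀]`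
on `P`, `q` even, `qP = 0`): any two classes outside differ by a class inside (§1), so the index is `1` or `2`.  This is hypothesis
`(M u).index ≤ 2` of `exists_mem_kummerOutside_four_localization_mem_two_nsmul_ne_zero_of_index_le_two`. [folklore] -/
theorem index_halfTransverseLocal_le_two (g₀ : absoluteGaloisGroup E) {q : ℤ} (hq : (2 : ℤ) ∣ q)
    (hF : ∀ Q : geomTorsion W n, absGaloisRestrict K E g₀ • absGaloisRestrict K E g₀ • Q = Q)
    {P : geomTorsion W n}
    (hgen : ∀ Q : geomTorsion W n, ∃ x y : ℤ, Q = x • P + y • absGaloisRestrict K E g₀ • P)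
    (hfree : ∀ x y : ℤ, x • P + y • absGaloisRestrict K E g₀ • P = 0 → q ∣ x ∧ q ∣ y) :
    (halfTransverseLocal W n E g₀).index ≤ 2 := by
  set M := halfTransverseLocal W n E g₀ with hM
  by_cases htop : ∀ c, c ∈ M
  · have : M = ⊤ := (AddSubgroup.eq_top_iff' M).mpr htop
    rw [this, AddSubgroup.index_top]
    norm_num
  · push Not at htop
    obtain ⟨c₀, hc₀⟩ := htop
    have h2 : M.index = 2 := by
      rw [AddSubgroup.index_eq_two_iff]
      refine ⟨c₀, fun b ↦ ?_⟩
      by_cases hb : b ∈ M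
      · refine Or.inr ⟨hb, fun hba ↦ hc₀ ?_⟩
        have : c₀ = (b + c₀) - b := by abel
        rw [this]
        exact M.sub_mem hba hb
      · refine Or.inl ⟨?_, hb⟩
        obtain ⟨fb, rfl⟩ := oneCocycleClass_surjective _ b
        obtain ⟨f₀, rfl⟩ := oneCocycleClass_surjective _ c₀
        rw [hM, mem_halfTransverseLocal_iff fb rfl] at hb
        rw [hM, mem_halfTransverseLocal_iff f₀ rfl] at hc₀
        refine ⟨fb + f₀, oneCocycleClass_add _ fb f₀, ?_⟩
        rw [Submodule.coe_add, ContinuousMap.add_apply]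
        exact add_mem_smulSubAddTwo_of_not_mem W hF hq hfree hgen hb hc₀
    rw [h2]

end Index

/-! ## §4 Bridge to global classes and to the Frobenius of I7 / I7½ -/

section Bridge

variable {K : Type} [Field K] [NumberField K] {v : HeightOneSpectrum (𝓞 K)}

section Classes

variable (W : WeierstrassCurve K) (n : ℤ)

/-- **For a global class `y`, `loc_v y ∈ halfTransverseLocal W n K_v g₀ ↔ [y, res g₀] ∈ (res g₀ − 1)T + 2T`** — the value of the
chosen cocycle of `y` at `res g₀` (`h1Eval`), i.e. the half-transversality hypothesis `hx`/`hy` of `…RTHalfTransverseIsotropic` at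
`F := res g₀` (there written with `F • P₁ − P₁`).  Proof: `loc_v y` is the class of the pulled-back chosen cocycle
(`res_oneCocycleClass`, `oneCocycleClass_reprCocycle`), whose value at `g₀` is `[y, res g₀]`; then §2. [folklore] -/
theorem localization_mem_halfTransverseLocal_iff (g₀ : absoluteGaloisGroup (v.adicCompletion K)) (y : galH1Torsion W n) :
    galoisCohomology.localization (W.torsionGaloisModule n) (Sum.inr v) 1 y ∈
        halfTransverseLocal W n (v.adicCompletion K) g₀ ↔
      ∃ a b : geomTorsion W n, h1Eval W n y (resGal (K := K) (v.adicCompletion K) g₀) =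
        (resGal (K := K) (v.adicCompletion K) g₀ • a - a) + (2 : ℤ) • b := by
  have hy := galoisCohomology.res_oneCocycleClass (W.torsionGaloisModule n) (v.adicCompletion K) (reprCocycle W n y)
  have hcl : ∀ z : galH1Torsion W n,
      oneCocycleClass ((W.torsionGaloisModule n).toTopRep) (reprCocycle W n z) = z :=
    oneCocycleClass_reprCocycle W n
  rw [hcl] at hy
  change galoisCohomology.res (W.torsionGaloisModule n) (v.adicCompletion K) 1 y ∈
      halfTransverseLocal W n (v.adicCompletion K) g₀ ↔ _
  rw [mem_halfTransverseLocal_iff _ hy.symm]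
  rfl

end Classes

/-- **Every element of the decomposition group `D_𝔓`, `𝔓 = ι₀⁻¹𝔐` the prime of `\bar ℤ_K` above `v` cut out by the chosen embedding
`ι₀ : K̄ → \bar K_v` (the prime of I7 / I7½ / `lemma_5_3_descent_of_reciprocity_rat_two`), is the restriction of an element of `Γ_{K_v}`**:
`D_𝔓 = res Γ_{K_v}`.  In particular an arithmetic Frobenius `F` at `𝔓` is `res g₀` for some `g₀`, so the engine may
define its local condition at a deep own prime as `halfTransverseLocal W n K_v g₀` BEFORE choosing the new prime.  Proof:
`D_{𝔓₀} = range res` for the tree's `adicCompletionPrime` (`decompositionSubgroup_adicCompletionPrime_eq_range`), `range res ≤ D_𝔓`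
(`resGalOfEmb_mem_decompositionSubgroup`), hence `𝔓₀ = 𝔓` (`eq_of_decompositionSubgroup_le`). [cite: NeukirchANT1999, Ch. II §9 Prop. (9.6)] -/
theorem exists_absGaloisRestrict_eq_of_mem_decompositionSubgroup {𝔐 : Ideal (HeightOneSpectrum.localAbsIntegers v)}
    (h𝔐 : 𝔐 ∈ v.localPrimesAbove) {F : absoluteGaloisGroup K}
    (hF : F ∈ (v.primeBelow (closureEmb (K := K) (v.adicCompletion K)) 𝔐).decompositionSubgroup (absoluteGaloisGroup K)) :
    ∃ g₀ : absoluteGaloisGroup (v.adicCompletion K), absGaloisRestrict K (v.adicCompletion K) g₀ = F := by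
  set 𝔓 := v.primeBelow (closureEmb (K := K) (v.adicCompletion K)) 𝔐 with h𝔓def
  have h𝔓 : 𝔓 ∈ v.primesAbove := HeightOneSpectrum.primeBelow_mem_primesAbove h𝔐
  -- `range res ≤ D_𝔓`
  have hle : (adicCompletionPrime K v).decompositionSubgroup (absoluteGaloisGroup K) ≤
      𝔓.decompositionSubgroup (absoluteGaloisGroup K) := by
    rw [decompositionSubgroup_adicCompletionPrime_eq_range]
    rintro _ ⟨g, rfl⟩
    have h := resGalOfEmb_mem_decompositionSubgroup (closureEmb (K := K) (v.adicCompletion K)) h𝔐 g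
    rwa [← resGal_eq] at h
  have heq : adicCompletionPrime K v = 𝔓 := eq_of_decompositionSubgroup_le K (adicCompletionPrime_mem_primesAbove K v) h𝔓 hle
  have hFD : F ∈ 𝔓.decompositionSubgroup (absoluteGaloisGroup K) := hF
  rw [← heq, decompositionSubgroup_adicCompletionPrime_eq_range] at hFD
  obtain ⟨g₀, hg₀⟩ := hFD
  exact ⟨g₀, hg₀⟩

/-- The same for an arithmetic Frobenius `F` at `𝔓` (`IsArithFrobAt`), the hypothesis `hFrob` of the I7 / I7½ theorems. [folklore] -/
theorem exists_absGaloisRestrict_eq_of_isArithFrobAt {𝔐 : Ideal (HeightOneSpectrum.localAbsIntegers v)}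
    (h𝔐 : 𝔐 ∈ v.localPrimesAbove) {F : absoluteGaloisGroup K}
    (hFrob : IsArithFrobAt (𝓞 K) F (v.primeBelow (closureEmb (K := K) (v.adicCompletion K)) 𝔐)) :
    ∃ g₀ : absoluteGaloisGroup (v.adicCompletion K), absGaloisRestrict K (v.adicCompletion K) g₀ = F := by
  haveI : (v.primeBelow (closureEmb (K := K) (v.adicCompletion K)) 𝔐).IsPrime :=
    (HeightOneSpectrum.primeBelow_mem_primesAbove h𝔐).1
  exact exists_absGaloisRestrict_eq_of_mem_decompositionSubgroup h𝔐 hFrob.mem_stabilizer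

end Bridge

end Summit.BirchSwinnertonDyer.BirchSwinnertonDyer.Theorems.GenusExact.TransverseIsotropy

end
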